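import HarnessLib
import Summits.RiemannHypothesis.RiemannHypothesis.Theorems.SignConePointwiseCheckerDefs

/-!
# Route SignCone: soundness of the pointwise-certificate checker

Support for the unconditional rungs of `SignConeOscillatory` / `SignConeInequality`
(items stmt-RiemannHypothesis-16302 / 16301). Soundness of the checks of
`SignConePointwiseCheckerDefs.lean` for the density
`F_D(y) = Re ψ(1/4 + iy/2) − log π + s + Ê_χ(y) − Σ_n a_n cos(y log n)`:

* `cell_sound`: a passing cell `[u, v]` has `F_D ≥ 0` on it — certified lower bound of `Re ψ` at `u`
  and monotonicity in `|y|`, the enclosures of `Ê_χ(u)` and of the comb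
  (`SignConePointwiseChecker.lean`), the Lipschitz constants of `Ê_χ`
  (`SignConePointwiseLipschitz.lean`) and of the comb (`|cos a − cos b| ≤ |a − b|`);
* `grid_sound`, `chain_sound`, `tail_sound` (decay of `Ê_χ`, `SignConePointwiseBounds.lean`), `F_neg`;
* **`PWData.F_nonneg_of_checks`**: scalar checks for `Y₀` + grids chaining from `0` to `Y₀`, each
  passing `checkGrid`, imply `∀ y, 0 ≤ F_D(y)`.
-/

noncomputable section

-- `Summit.RiemannHypothesis.RiemannHypothesis.…` repeats a namespace component by design (D-0017 layout).
set_option linter.dupNamespace false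

open Real

namespace Summit.RiemannHypothesis.RiemannHypothesis.Theorems.SignCone

open Literature.Analysis.ValidatedNumerics.Numerics Literature.NumberTheory.LFunctions
open Literature.Analysis.SpecialFunctions (reDigammaQuarter reDigammaQuarter_mono reDigammaQuarter_even)

namespace PWData

variable {D : PWData}

/-- Unpacking `checkScalars`. [folklore] -/
theorem check_spec {Y0 : ℚ} (h : D.checkScalars Y0 = true) :
    0 ≤ D.d.L ∧ 0 < D.d.h ∧ D.nodeList.Nodup ∧ (∀ n ∈ D.nodeList, 0 ≤ D.a n ∧ n ≤ D.logN ∧ 1 ≤ n) ∧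
      FI.logTableOK D.logN = true ∧ D.checkKnots = true ∧ D.checkSlope = true ∧ D.checkTail Y0 = true := by
  unfold checkScalars at h
  simp only [Bool.and_eq_true, decide_eq_true_eq, List.all_eq_true] at h
  obtain ⟨⟨⟨⟨⟨⟨⟨hL, hh⟩, hnd⟩, hall⟩, hlog⟩, hkn⟩, hslope⟩, htail⟩ := h
  exact ⟨hL, hh, hnd, fun n hn => ⟨(hall n hn).1.1, (hall n hn).1.2, (hall n hn).2⟩, hlog, hkn, hslope, htail⟩

/-- Knot data are genuine enclosures for `k ≤ K + 1`. [folklore] -/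
theorem csAt_mem {Y0 : ℚ} (h : D.checkScalars Y0 = true) {k : ℕ} (hk : k ≤ D.d.K + 1) :
    (FI.mem (Real.cosh ((D.d.knot k : ℝ) / 2)) (D.csAt k).1 ∧
        FI.mem (Real.sinh ((D.d.knot k : ℝ) / 2)) (D.csAt k).2) ∧
      FI.mem (Real.exp ((D.d.knot k : ℝ) / 2)) (D.expAt k) := by
  have hkn := (check_spec h).2.2.2.2.2.1
  unfold checkKnots at hkn
  have hk' := of_allBelow hkn (k := k) (by omega)
  rw [Bool.and_eq_true, Option.isSome_iff_exists, Option.isSome_iff_exists] at hk'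
  obtain ⟨⟨cs, hcs⟩, ⟨e, he⟩⟩ := hk'
  refine ⟨?_, ?_⟩
  · unfold csAt; rw [hcs, Option.getD_some]; exact PW.mem_coshSinhFI hcs
  · unfold expAt; rw [he, Option.getD_some]
    have := PW.mem_expFI he
    push_cast at this
    exact this

/-- The comb over a list: Lipschitz in `y` and bounded above by `Σ a_n`. [folklore] -/
theorem comb_list_bounds {N : ℕ} (hlog : FI.logTableOK N = true) (a : ℕ → ℚ) :
    ∀ l : List ℕ, (∀ n ∈ l, 0 ≤ a n ∧ n ≤ N ∧ 1 ≤ n) → ∀ y u : ℝ,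
      ((l.map fun n => (a n : ℝ) * Real.cos (y * Real.log n)).sum -
          (l.map fun n => (a n : ℝ) * Real.cos (u * Real.log n)).sum ≤
        ((l.map fun n => a n * ((FI.logTable N).getD n (FI.ofInt 0)).hiQ).sum : ℚ) * |y - u|) ∧
      (l.map fun n => (a n : ℝ) * Real.cos (y * Real.log n)).sum ≤ ((l.map a).sum : ℚ)
  | [], _, y, u => by simp
  | n :: t, hl, y, u => by
    obtain ⟨ha, hnN, hn1⟩ := hl n (by simp)
    have ih := comb_list_bounds hlog a t (fun m hm => hl m (by simp [hm])) y u
    have ha' : (0 : ℝ) ≤ a n := by exact_mod_cast ha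
    have hlogn : 0 ≤ Real.log n := Real.log_nonneg (by exact_mod_cast hn1)
    have hhi : Real.log n ≤ (((FI.logTable N).getD n (FI.ofInt 0)).hiQ : ℝ) :=
      FI.le_hiQ (FI.mem_logTable hlog hnN)
    simp only [List.map_cons, List.sum_cons]
    push_cast
    constructor
    · have hc := Real.abs_cos_sub_cos_le (y * Real.log n) (u * Real.log n)
      rw [← sub_mul, abs_mul, abs_of_nonneg hlogn] at hc
      have h1 : (a n : ℝ) * Real.cos (y * Real.log n) - (a n : ℝ) * Real.cos (u * Real.log n) ≤
          (a n : ℝ) * (((FI.logTable N).getD n (FI.ofInt 0)).hiQ : ℝ) * |y - u| := by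
        rw [← mul_sub]
        calc (a n : ℝ) * (Real.cos (y * Real.log n) - Real.cos (u * Real.log n))
            ≤ (a n : ℝ) * (|y - u| * Real.log n) :=
              mul_le_mul_of_nonneg_left ((le_abs_self _).trans hc) ha'
          _ ≤ (a n : ℝ) * (|y - u| * (((FI.logTable N).getD n (FI.ofInt 0)).hiQ : ℝ)) :=
              mul_le_mul_of_nonneg_left (mul_le_mul_of_nonneg_left hhi (abs_nonneg _)) ha'
          _ = (a n : ℝ) * (((FI.logTable N).getD n (FI.ofInt 0)).hiQ : ℝ) * |y - u| := by ring
      push_cast at ih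
      nlinarith [ih.1, h1]
    · have h2 : (a n : ℝ) * Real.cos (y * Real.log n) ≤ a n := by
        have := Real.cos_le_one (y * Real.log n)
        nlinarith
      push_cast at ih
      linarith [ih.2, h2]

/-- `lastQ (v :: rest) = lastQ (u :: v :: rest)`. [folklore] -/
theorem lastQ_cons_cons (u v : ℚ) (rest : List ℚ) : lastQ (u :: v :: rest) = lastQ (v :: rest) := rfl

/-- **Cell soundness.** A passing cell `[u, v]` with `0 ≤ u` has `F_D ≥ 0` on it. [folklore] -/
theorem cell_sound {Y0 : ℚ} (h : D.checkScalars Y0 = true) {u v : ℚ} (hu : 0 ≤ u) (hok : D.cellOK u v = true) :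
    u ≤ v ∧ ∀ y : ℝ, (u : ℝ) ≤ y → y ≤ v → 0 ≤ D.F y := by
  obtain ⟨hL, hh, hnd, hall, hlog, -, hslope, -⟩ := check_spec h
  unfold cellOK at hok
  split at hok
  · rename_i q hq
    rw [Bool.and_eq_true, decide_eq_true_eq, decide_eq_true_eq] at hok
    refine ⟨hok.2, fun y huy hyv => ?_⟩
    unfold cellLo at hq
    split at hq
    · rename_i Z0 W hZ hW
      simp only [Option.some.injEq] at hq
      have hu' : (0 : ℝ) ≤ u := by exact_mod_cast hu
      -- (1) digamma
      have h1 : ((wLoQ D.prec u (D.mwAt u) : ℚ) : ℝ) ≤ reDigammaQuarter y :=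
        (wLoQ_le _ _ _).trans (reDigammaQuarter_mono (by
          rw [abs_of_nonneg hu', abs_of_nonneg (hu'.trans huy)]; exact huy))
      -- (2) log π
      have h2 : Real.log π ≤ ((logPiHi : ℚ) : ℝ) := logPiHi_ge
      -- (3) Ê(u) from the enclosure
      have hZk : ∀ k, CB.mem (Complex.exp ((((D.d.knot k : ℝ) * u : ℝ)) * Complex.I))
          (CB.mul Z0 (PW.cbPow W k)) := fun k => by
        have := PW.mem_knotTrig hZ hW k
        convert this using 3
        unfold PWKernel.knot; push_cast; ring
      have h3 : (((PW.ehatFI D.d D.csAt (fun k => CB.mul Z0 (PW.cbPow W k)) u).loQ : ℚ) : ℝ) ≤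
          cosTransform D.d.kernelE u := by
        rw [PWKernel.cosTransform_kernelE_eq hL hh]
        exact FI.loQ_le (PW.mem_ehatFI D.d (fun k hk => (csAt_mem h (by omega)).1) hZk)
      -- (4) Lipschitz constant of Ê from `checkSlope`
      unfold checkSlope lipHi at hslope
      split at hslope
      · rename_i e he
        split at he
        · rename_i Z0' W' CS hZ' hW' hCS
          simp only [Option.some.injEq] at he
          simp only [Bool.and_eq_true, decide_eq_true_eq] at hslope
          obtain ⟨⟨he0, hcs0⟩, hsl⟩ := hslope
          have hZk' : ∀ k, CB.mem (Complex.exp ((((D.d.absKernel.knot k : ℝ) * (0 : ℚ) : ℝ)) * Complex.I))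
              (CB.mul Z0' (PW.cbPow W' k)) := fun k => by
            have := PW.mem_knotTrig hZ' hW' k
            convert this using 3
            rw [PWKernel.absKernel_knot]
            unfold PWKernel.knot; push_cast; ring
          have hEabs : D.d.absKernel.ehatCF 0 ≤
              ((PW.ehatFI D.d.absKernel D.csAt (fun k => CB.mul Z0' (PW.cbPow W' k)) 0).hiQ : ℝ) := by
            have hm := PW.mem_ehatFI D.d.absKernel (cs := D.csAt) (fun k hk => by
              rw [PWKernel.absKernel_K] at hk
              exact (csAt_mem h (by omega)).1) hZk'
            push_cast at hm
            exact FI.le_hiQ hm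
          have hC := (PW.mem_coshSinhFI hCS).1
          have hS := (PW.mem_coshSinhFI hCS).2
          have hX : (0 : ℝ) ≤ D.d.knot D.d.K := PWKernel.knot_nonneg hL hh _
          have hL' : (0 : ℝ) ≤ D.d.L := by exact_mod_cast hL
          have hLip := abs_cosTransform_sub_le (PWKernel.continuous_kernelE D.d)
            (PWKernel.hasCompactSupport_kernelE hh) y u
          have hM1 := PWKernel.integral_abs_mul_abs_kernelE_le_sharp (d := D.d) hL hh
          have hMe : 2 * (4 * (D.d.L : ℝ) * Real.sinh (D.d.L / 2) - 8 * Real.cosh (D.d.L / 2) + 8) +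
              (D.d.knot D.d.K : ℝ) * (D.d.absKernel.ehatCF 0 - 8 * Real.sinh (D.d.L / 2)) ≤ e := by
            rw [← he]
            push_cast
            have h1 := FI.le_hiQ hS
            have h2 := FI.loQ_le hC
            have h3 := FI.loQ_le hS
            nlinarith [mul_le_mul_of_nonneg_left (sub_le_sub hEabs (mul_le_mul_of_nonneg_left h3 (by norm_num : (0:ℝ) ≤ 8))) hX]
          have h4 : cosTransform D.d.kernelE u - (e : ℝ) * |y - u| ≤ cosTransform D.d.kernelE y := by
            have : |cosTransform D.d.kernelE y - cosTransform D.d.kernelE u| ≤ (e : ℝ) * |y - u| :=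
              hLip.trans (mul_le_mul_of_nonneg_right (hM1.trans hMe) (abs_nonneg _))
            linarith [(abs_sub_le_iff.1 this).2]
          -- (5) the comb
          have hcb := comb_list_bounds hlog D.a D.nodeList hall y u
          rw [← List.sum_toFinset _ hnd, ← List.sum_toFinset _ hnd] at hcb
          have h5 : ((D.nodeList.map fun n => (D.a n : ℝ) * Real.cos ((u : ℝ) * Real.log n)).sum : ℝ) ≤
              (((PW.combFI D.nodeList D.a D.logN u).hiQ : ℚ) : ℝ) :=
            FI.le_hiQ (PW.mem_combFI hlog (fun n hn => (hall n hn).2.1) u)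
          rw [← List.sum_toFinset _ hnd] at h5
          -- (6) arithmetic
          have he0' : (0 : ℝ) ≤ e := by exact_mod_cast he0
          have hcs0' : (0 : ℝ) ≤ D.combSlopeQ := by exact_mod_cast hcs0
          have hsl' : ((e + D.combSlopeQ : ℚ) : ℝ) ≤ D.slope := by exact_mod_cast hsl
          push_cast at hsl'
          have hyu : |y - u| = y - u := abs_of_nonneg (by linarith)
          have hvu : y - (u : ℝ) ≤ (v : ℝ) - u := by linarith
          have hq0 : (0 : ℝ) ≤ q := by exact_mod_cast hok.1
          have hq' : ((wLoQ D.prec u (D.mwAt u) - logPiHi + D.s +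
              (PW.ehatFI D.d D.csAt (fun k => CB.mul Z0 (PW.cbPow W k)) u).loQ -
              (PW.combFI D.nodeList D.a D.logN u).hiQ - (v - u) * D.slope : ℚ) : ℝ) = q := by
            exact_mod_cast hq
          push_cast at hq'
          have hstep : ((e : ℝ) + D.combSlopeQ) * |y - u| ≤ (D.slope : ℝ) * ((v : ℝ) - u) := by
            rw [hyu]
            calc ((e : ℝ) + D.combSlopeQ) * (y - u)
                ≤ ((e : ℝ) + D.combSlopeQ) * ((v : ℝ) - u) :=
                  mul_le_mul_of_nonneg_left hvu (add_nonneg he0' hcs0')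
              _ ≤ (D.slope : ℝ) * ((v : ℝ) - u) :=
                  mul_le_mul_of_nonneg_right hsl' (by linarith)
          have ecs : ((List.map (fun n => D.a n * ((FI.logTable D.logN).getD n (FI.ofInt 0)).hiQ) D.nodeList).sum : ℚ) =
              D.combSlopeQ := rfl
          rw [ecs] at hcb
          have hcomb := hcb.1
          rw [add_mul] at hstep
          have hvs : ((v : ℝ) - u) * (D.slope : ℝ) = (D.slope : ℝ) * ((v : ℝ) - u) := mul_comm _ _
          unfold F
          linarith [h1, h2, h3, h4, hcomb, h5, hstep, hq0, hq', hvs]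
        · simp at he
      · simp at hslope
    · simp at hq
  · simp at hok

/-- **Grid soundness.** A passing grid `u :: v :: rest` with `0 ≤ u` has `F_D ≥ 0` on `[u, lastQ]`. [folklore] -/
theorem grid_sound {Y0 : ℚ} (h : D.checkScalars Y0 = true) :
    ∀ (rest : List ℚ) (u v : ℚ), 0 ≤ u → D.checkGrid (u :: v :: rest) = true →
      u ≤ lastQ (u :: v :: rest) ∧ ∀ y : ℝ, (u : ℝ) ≤ y → y ≤ lastQ (u :: v :: rest) → 0 ≤ D.F y
  | [], u, v, hu, hg => by
    have hc : D.cellOK u v = true := by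
      simp only [checkGrid, Bool.and_eq_true] at hg; exact hg.1
    have hcs := cell_sound h hu hc
    refine ⟨by simpa [lastQ] using hcs.1, fun y h1 h2 => hcs.2 y h1 (by simpa [lastQ] using h2)⟩
  | w :: rest, u, v, hu, hg => by
    have hg' : D.cellOK u v = true ∧ D.checkGrid (v :: w :: rest) = true := by
      simp only [checkGrid, Bool.and_eq_true] at hg ⊢; exact ⟨hg.1, hg.2⟩
    have hcs := cell_sound h hu hg'.1
    have hv : 0 ≤ v := hu.trans hcs.1
    have ih := grid_sound h rest v w hv hg'.2
    rw [lastQ_cons_cons]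
    refine ⟨hcs.1.trans ih.1, fun y h1 h2 => ?_⟩
    rcases le_or_gt y (v : ℝ) with hyv | hyv
    · exact hcs.2 y h1 hyv
    · exact ih.2 y hyv.le h2

/-- `decayConst ∈ decayFI`. [folklore] -/
theorem mem_decayFI {Y0 : ℚ} (h : D.checkScalars Y0 = true) : FI.mem D.d.decayConst D.decayFI := by
  have hK : 1 ≤ D.d.K := Nat.succ_le_of_lt (Nat.succ_pos _)
  have hE : ∀ k ≤ D.d.K + 1, FI.mem (Real.exp ((D.d.knot k : ℝ) / 2)) (D.expAt k) :=
    fun k hk => (csAt_mem h hk).2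
  unfold decayFI PWKernel.decayConst
  refine FI.mem_mul (by exact_mod_cast FI.mem_ofRat 4) (FI.mem_add ?_ (PW.mem_fiSumIco D.d.K (fun k h1 h2 => ?_)))
  · have := FI.mem_mul (FI.mem_add (hE 1 (by omega)) (hE 0 (by omega))) (FI.mem_ofRat (1 / D.d.h))
    convert this using 1; push_cast; ring
  · have := FI.mem_mul (FI.mem_ofRat |D.d.chiAt k|) (FI.mem_mul (FI.mem_add (FI.mem_add (hE (k - 1) (by omega))
      (FI.mem_mul (FI.mem_ofRat 2) (hE k (by omega)))) (hE (k + 1) (by omega))) (FI.mem_ofRat (1 / D.d.h)))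
    convert this using 1; push_cast; ring

/-- `0 ≤ decayConst`. [folklore] -/
theorem decayConst_nonneg {Y0 : ℚ} (h : D.checkScalars Y0 = true) : 0 ≤ D.d.decayConst := by
  obtain ⟨-, hh, -⟩ := check_spec h
  have hh' : (0 : ℝ) < D.d.h := by exact_mod_cast hh
  unfold PWKernel.decayConst
  refine mul_nonneg (by norm_num) (add_nonneg (by positivity) (Finset.sum_nonneg fun k _ => ?_))
  exact mul_nonneg (abs_nonneg _) (by positivity)

/-- **Tail soundness.** `F_D ≥ 0` on `[Y₀, ∞)` when `Y₀ = lastQ ys ≥ 0`. [folklore] -/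
theorem tail_sound {Y0 : ℚ} (h : D.checkScalars Y0 = true) (hY : 0 ≤ Y0) :
    ∀ y : ℝ, (Y0 : ℝ) ≤ y → 0 ≤ D.F y := by
  obtain ⟨hL, hh, hnd, hall, hlog, -, -, htail⟩ := check_spec h
  intro y hy
  have hY' : (0 : ℝ) ≤ Y0 := by exact_mod_cast hY
  unfold checkTail at htail
  rw [decide_eq_true_eq] at htail
  have ht : ((0 : ℚ) : ℝ) ≤ ((wLoQ D.prec Y0 D.mwT - logPiHi + D.s - (D.nodeList.map D.a).sum -
      D.decayFI.hiQ / (1 / 4 + Y0 * Y0) : ℚ) : ℝ) := by exact_mod_cast htail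
  push_cast at ht
  -- digamma, log π
  have h1 : ((wLoQ D.prec Y0 D.mwT : ℚ) : ℝ) ≤ reDigammaQuarter y :=
    (wLoQ_le _ _ _).trans (reDigammaQuarter_mono (by
      rw [abs_of_nonneg hY', abs_of_nonneg (hY'.trans hy)]; exact hy))
  have h2 : Real.log π ≤ ((logPiHi : ℚ) : ℝ) := logPiHi_ge
  -- decay of Ê
  have hdec := PWKernel.abs_cosTransform_kernelE_le (d := D.d) hL hh y
  have hCE : D.d.decayConst ≤ (D.decayFI.hiQ : ℝ) := FI.le_hiQ (mem_decayFI h)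
  have hC0 := decayConst_nonneg h
  have hD0 : (0 : ℝ) < 1 / 4 + (Y0 : ℝ) * Y0 := by nlinarith [mul_self_nonneg (Y0 : ℝ)]
  have hDy : (1 / 4 : ℝ) + (Y0 : ℝ) * Y0 ≤ 1 / 4 + y ^ 2 := by nlinarith
  have h3 : |cosTransform D.d.kernelE y| ≤ (D.decayFI.hiQ : ℝ) / (1 / 4 + (Y0 : ℝ) * Y0) :=
    hdec.trans ((div_le_div_of_nonneg_left hC0 hD0 hDy).trans
      (div_le_div_of_nonneg_right hCE hD0.le))
  -- the comb
  have hcb := (comb_list_bounds hlog D.a D.nodeList hall y y).2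
  rw [← List.sum_toFinset _ hnd] at hcb
  push_cast at hcb
  unfold F
  have h4 := neg_abs_le (cosTransform D.d.kernelE y)
  linarith [h1, h2, h3, h4, hcb, ht]

/-- `F_D` is even. [folklore] -/
theorem F_neg (y : ℝ) : D.F (-y) = D.F y := by
  unfold F
  rw [reDigammaQuarter_even, cosTransform_neg]
  congr 1
  refine Finset.sum_congr rfl fun n _ => ?_
  rw [neg_mul, Real.cos_neg]

/-- **Chain soundness.** Grids chaining from `st ≥ 0` to `Y₀`, all passing, cover `[st, Y₀]`, and
`st ≤ Y₀`. [folklore] -/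
theorem chain_sound {Y0 : ℚ} (h : D.checkScalars Y0 = true) :
    ∀ (gs : List (List ℚ)) (st : ℚ), 0 ≤ st → chainOK gs st Y0 = true → (∀ g ∈ gs, D.checkGrid g = true) →
      st ≤ Y0 ∧ ∀ y : ℝ, (st : ℝ) ≤ y → y ≤ Y0 → 0 ≤ D.F y
  | [], st, hst, hch, _ => by
    simp only [chainOK, decide_eq_true_eq] at hch
    subst hch
    exact ⟨le_rfl, fun y h1 _ => tail_sound h hst y h1⟩
  | g :: rest, st, hst, hch, hgs => by
    simp only [chainOK, Bool.and_eq_true, decide_eq_true_eq] at hch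
    obtain ⟨hhead, hrest⟩ := hch
    have hg : D.checkGrid g = true := hgs g (by simp)
    have hgs' : ∀ g' ∈ rest, D.checkGrid g' = true := fun g' hg' => hgs g' (by simp [hg'])
    match g, hhead, hg with
    | [], hhead, _ => simp at hhead
    | [x], hhead, _ =>
      simp only [List.head?_cons, Option.some.injEq] at hhead
      subst hhead
      have ih := chain_sound h rest (lastQ [x]) (by simpa [lastQ] using hst) hrest hgs'
      simp only [lastQ] at ih
      exact ih
    | u :: v :: r, hhead, hg =>
      simp only [List.head?_cons, Option.some.injEq] at hhead
      subst hhead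
      have hgr := grid_sound h r u v hst hg
      have ih := chain_sound h rest (lastQ (u :: v :: r)) (hst.trans hgr.1) hrest hgs'
      refine ⟨hgr.1.trans ih.1, fun y h1 h2 => ?_⟩
      rcases le_or_gt y (lastQ (u :: v :: r) : ℝ) with hy | hy
      · exact hgr.2 y h1 hy
      · exact ih.2 y hy.le h2

/-- **Soundness of the pointwise checker.** If the scalar checks pass for `Y₀` and a family of grids
chaining from `0` to `Y₀` passes cell by cell, then `F_D(y) ≥ 0` for every real `y`. [folklore] -/
theorem F_nonneg_of_checks {Y0 : ℚ} (h : D.checkScalars Y0 = true) (gs : List (List ℚ))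
    (hch : chainOK gs 0 Y0 = true) (hgs : ∀ g ∈ gs, D.checkGrid g = true) (y : ℝ) : 0 ≤ D.F y := by
  wlog hy : 0 ≤ y generalizing y with H
  · have := H (-y) (by linarith); rwa [F_neg] at this
  have hc := chain_sound h gs 0 le_rfl hch hgs
  rcases le_or_gt y (Y0 : ℝ) with hyY | hyY
  · exact hc.2 y (by exact_mod_cast hy) hyY
  · exact tail_sound h hc.1 y hyY.le

end PWData

end Summit.RiemannHypothesis.RiemannHypothesis.Theorems.SignCone

end
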